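import Literature.AlgebraicGeometry.Motives.MixedHodgeStructureCatWeightFiltration
import Literature.AlgebraicGeometry.Motives.MixedHodgeStructureTateTwist
import Literature.AlgebraicGeometry.Motives.MixedHodgeStructureHodgeClasses
import Literature.AlgebraicGeometry.Motives.HodgeStructureFibreFunctor
import Literature.AlgebraicGeometry.Motives.MixedHodgeStructureInternalHomCurry
import HarnessLib

/-!
# The Tate twist `X ↦ X(j)` as an exact autoequivalence of `MixedHodgeStructureCat`, and its compatibility with `W_•`, `Gr^W_•`
# and Hodge classes

Layer `Literature/AlgebraicGeometry/Motives` (lane `lit-hodgefound`).  Cattani–El Zein–Griffiths–Lê, Ex. 3.2.23 (4): the Tate twist `H(m)`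
of a mixed Hodge structure, `W_r H(m) := W_{r+2m} H`, `F^r H(m) := F^{r+m} H` (Deligne, *Hodge II*, 2.1.13–2.1.14: `H(n) = H ⊗ ℤ(n)`); the
tree has it UNBUNDLED (`MixedHodgeStructure.tateTwist`, `Hom.tateTwist`, `tateTwist_tateTwist : H(j)(j') = H(j+j')`, `tateTwist_zero`,
`tateTwistGrHom : Gr^W_k H(j) → (Gr^W_{k+2j} H)(j)` bijective).  In the bundled abelian category `MixedHodgeStructureCat` (g43-#3) this
file packages:

* §1 the functor **`tateTwist j : MixedHodgeStructureCat ⥤ MixedHodgeStructureCat`** (same underlying spaces and maps): additive,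
  `ℚ`-linear, full, faithful, exact (`PreservesHomology`, `PreservesFiniteLimits`, `PreservesFiniteColimits`), `tateTwist j ⋙ forget ≅ forget`;
* §2 **the autoequivalence `tateTwistEquivalence j : MixedHodgeStructureCat ≌ MixedHodgeStructureCat`** (inverse `tateTwist (-j)`, unit and
  counit the identity maps `X ≅ X(j)(-j)`), via the tree's identity morphism `MixedHodgeStructure.Hom.ofEq` between equal structures;
* §3 compatibilities: `W_k(X(j)) = W_{k+2j}(X)` (`coe_subobjectEquiv_weightSubobject_tateTwist_obj`, `isZero_weightFunctor_obj_tateTwist_obj_iff`,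
  `isIso_weightι_app_tateTwist_obj_iff`), **`tateTwistGrIso : tateTwist j ⋙ gr k ≅ gr (k + 2j) ⋙ HodgeStructureCat.tateTwist (k + 2j) j ⋙ castFunctor _`** (`Gr^W_k(X(j)) ≅
  (Gr^W_{k+2j} X)(j)`), purity and weights of twists, and **`hodgeClasses_tateTwist_obj : Hdgᵖ(X(j)) = Hdg^{p+j}(X)`**.

Definitions with bodies (`tateTwist`, `tateTwistCompForgetIso`, `tateTwistTwistIso`, `tateTwistEquivalence`,
`tateTwistGrIso`) and theorems; instances only on this file's own functor `tateTwist j` (`Additive`, `Linear ℚ`,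
`Full`, `Faithful`, `PreservesHomology`, `PreservesFinite(Co)Limits`, `IsEquivalence`); no notion, no named fact (0 new facts), no notation.

## Sources, verbatim

* E. Cattani, F. El Zein, P. Griffiths, Lê D. T. (eds.), *Hodge Theory* (Princeton Math. Notes 49, 2014), Ex. 3.2.23 (4) (held text p0163):
  the twisted MHS `H(m)` with `W_r H(m) := W_{r+2m} H` and `F^r H(m) := F^{r+m} H`; Ex. 3.1.5 (p0132): «its `m`-twist is an HS of weight
  `n - 2m`», `ℤ(m) = ℤ(1) ⊗ ⋯ ⊗ ℤ(1)`.
* P. Deligne, *Théorie de Hodge II*, Publ. Math. IHÉS 40 (1971), 2.1.13–2.1.14 (`ℤ(1)`, `H(n) := H ⊗ ℤ(n)`), 2.3.1.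

## References

* [CattaniElZeinGriffithsLe2014] E. Cattani et al. (eds.), Hodge Theory (2014), Ex. 3.1.5, Ex. 3.2.23 (4).
* [DeligneHodgeII1971] P. Deligne, Théorie de Hodge II, Publ. Math. IHÉS 40 (1971), 2.1.13–2.1.14, 2.3.1.
* [Arapura2022] D. Arapura, Hodge cycles and the Leray filtration, Pacific J. Math. 319 (2022), §1 (`Hodge(H(p))`).

## Provenance

Lane `lit-hodgefound` (summit `HodgeConjecture`), seat `lit-hodgefound-p36` (literature-prover, generation 43, row g43-#12).
-/

noncomputable section

open CategoryTheory CategoryTheory.Limits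

namespace Literature.AlgebraicGeometry.Motives

universe u


namespace MixedHodgeStructureCat

/-! ## §1 The Tate twist functor -/

/-- **The Tate twist `X ↦ X(j)` on `MixedHodgeStructureCat`** (`W_k X(j) = W_{k+2j} X`, `F^p X(j) = F^{p+j} X`; morphisms keep their
underlying maps). [cite: CattaniElZeinGriffithsLe2014, Ex. 3.2.23 (4)] [cite: DeligneHodgeII1971, 2.1.13–2.1.14] -/
def tateTwist (j : ℤ) : MixedHodgeStructureCat.{u} ⥤ MixedHodgeStructureCat.{u} where
  obj X := of (X.str.tateTwist j)
  map f := f.tateTwist j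

/-- The MHS of `X(j)` is `X.str.tateTwist j`. [cite: CattaniElZeinGriffithsLe2014, Ex. 3.2.23 (4)] -/
theorem tateTwist_obj (j : ℤ) (X : MixedHodgeStructureCat.{u}) : (tateTwist j).obj X = of (X.str.tateTwist j) := rfl

/-- `f(j)` has the same underlying map as `f`. [cite: CattaniElZeinGriffithsLe2014, Ex. 3.2.23 (4)] -/
@[simp]
theorem tateTwist_map_toLinearMap (j : ℤ) {X Y : MixedHodgeStructureCat.{u}} (f : X ⟶ Y) :
    MixedHodgeStructure.Hom.toLinearMap ((tateTwist j).map f) = f.toLinearMap := rfl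

/-- The Tate twist is additive. [cite: DeligneHodgeII1971, 2.1.13–2.1.14] -/
instance (j : ℤ) : (tateTwist.{u} j).Additive where

/-- The Tate twist is `ℚ`-linear. [cite: DeligneHodgeII1971, 2.1.13–2.1.14] -/
instance (j : ℤ) : (tateTwist.{u} j).Linear ℚ where

/-- The Tate twist is faithful. [cite: DeligneHodgeII1971, 2.1.13–2.1.14] -/
instance (j : ℤ) : (tateTwist.{u} j).Faithful where
  map_injective h := MixedHodgeStructure.Hom.ext (by
    have h' := congrArg MixedHodgeStructure.Hom.toLinearMap h
    exact h')

/-- **The Tate twist is full**: a morphism `X(j) → Y(j)` is a morphism `X → Y` (same conditions on `W_{•+2j}`, `F^{•+j}`).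
[cite: CattaniElZeinGriffithsLe2014, Ex. 3.2.23 (4)] -/
instance (j : ℤ) : (tateTwist.{u} j).Full where
  map_surjective {X Y} g :=
    ⟨{ toLinearMap := g.toLinearMap
       map_W_le := fun k => by
         have h : ((X.str.tateTwist j).W (k - 2 * j)).map g.toLinearMap ≤ (Y.str.tateTwist j).W (k - 2 * j) := g.map_W_le (k - 2 * j)
         rwa [MixedHodgeStructure.tateTwist_W, MixedHodgeStructure.tateTwist_W, show k - 2 * j + 2 * j = k by ring] at h
       map_F_le := fun p => by
         have h : ((X.str.tateTwist j).F (p - j)).map (g.toLinearMap.baseChange ℂ) ≤ (Y.str.tateTwist j).F (p - j) := g.map_F_le (p - j)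
         rwa [MixedHodgeStructure.tateTwist_F, MixedHodgeStructure.tateTwist_F, show p - j + j = p by ring] at h },
      MixedHodgeStructure.Hom.ext rfl⟩

/-- **The Tate twist commutes with the fibre functor**: `X(j)` has the same underlying space. [cite: DeligneHodgeII1971, 2.1.13–2.1.14] -/
def tateTwistCompForgetIso (j : ℤ) : tateTwist.{u} j ⋙ forget ≅ forget := NatIso.ofComponents (fun _ => Iso.refl _) (fun _ => rfl)

/-- **The Tate twist is exact** (same underlying sequences of linear maps). [cite: CattaniElZeinGriffithsLe2014, Ex. 3.2.23 (4)] -/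
theorem tateTwist_map_exact_iff (j : ℤ) (S : ShortComplex MixedHodgeStructureCat.{u}) : (S.map (tateTwist j)).Exact ↔ S.Exact :=
  (exact_iff _).trans (Iff.trans Iff.rfl (exact_iff S).symm)

/-- The Tate twist preserves homology. [cite: CattaniElZeinGriffithsLe2014, Ex. 3.2.23 (4)] -/
instance (j : ℤ) : (tateTwist.{u} j).PreservesHomology :=
  ((tateTwist.{u} j).exact_tfae.out 1 2).1 fun S hS => (tateTwist_map_exact_iff j S).2 hS

/-- The Tate twist is left exact. [cite: CattaniElZeinGriffithsLe2014, Ex. 3.2.23 (4)] -/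
instance (j : ℤ) : PreservesFiniteLimits (tateTwist.{u} j) := (tateTwist.{u} j).preservesFiniteLimits_of_preservesHomology

/-- The Tate twist is right exact. [cite: CattaniElZeinGriffithsLe2014, Ex. 3.2.23 (4)] -/
instance (j : ℤ) : PreservesFiniteColimits (tateTwist.{u} j) := (tateTwist.{u} j).preservesFiniteColimits_of_preservesHomology

/-- `X(j)` is pure of weight `m` iff `X` is pure of weight `m + 2j` (the twist lowers weights by `2j`). [cite: CattaniElZeinGriffithsLe2014, Ex. 3.1.5] -/
theorem isPure_tateTwist_obj_iff (j m : ℤ) (X : MixedHodgeStructureCat.{u}) :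
    ((tateTwist j).obj X).str.IsPure m ↔ X.str.IsPure (m + 2 * j) :=
  X.str.isPure_tateTwist_iff j m

/-- `k` is a weight of `X(j)` iff `k + 2j` is a weight of `X`. [cite: CattaniElZeinGriffithsLe2014, Ex. 3.1.5] -/
theorem isWeight_tateTwist_obj_iff (j k : ℤ) (X : MixedHodgeStructureCat.{u}) :
    ((tateTwist j).obj X).str.IsWeight k ↔ X.str.IsWeight (k + 2 * j) :=
  X.str.isWeight_tateTwist_iff j k

/-! ## §2 The autoequivalence `X ↦ X(j)`, `X ↦ X(-j)` -/

/-- `X(j)(j') = X(j + j')` as objects of `MixedHodgeStructureCat`. [cite: CattaniElZeinGriffithsLe2014, Ex. 3.1.5] -/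
theorem tateTwist_obj_tateTwist_obj (j j' : ℤ) (X : MixedHodgeStructureCat.{u}) :
    (tateTwist j').obj ((tateTwist j).obj X) = (tateTwist (j + j')).obj X :=
  congrArg of (X.str.tateTwist_tateTwist j j')

/-- `X(0) = X` as objects of `MixedHodgeStructureCat`. [cite: CattaniElZeinGriffithsLe2014, Ex. 3.2.23 (4)] -/
theorem tateTwist_zero_obj (X : MixedHodgeStructureCat.{u}) : (tateTwist 0).obj X = X := by
  rw [tateTwist_obj, MixedHodgeStructure.tateTwist_zero]

/-- **`X(j)(j') ≅ X` for `j + j' = 0`**, the identity of the underlying space. [cite: CattaniElZeinGriffithsLe2014, Ex. 3.2.23 (4)] -/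
def tateTwistTwistIso (j j' : ℤ) (h : j + j' = 0) (X : MixedHodgeStructureCat.{u}) : (tateTwist j').obj ((tateTwist j).obj X) ≅ X where
  hom := MixedHodgeStructure.Hom.ofEq (show (X.str.tateTwist j).tateTwist j' = X.str by
    rw [MixedHodgeStructure.tateTwist_tateTwist, h, MixedHodgeStructure.tateTwist_zero])
  inv := MixedHodgeStructure.Hom.ofEq (show X.str = (X.str.tateTwist j).tateTwist j' by
    rw [MixedHodgeStructure.tateTwist_tateTwist, h, MixedHodgeStructure.tateTwist_zero])
  hom_inv_id := MixedHodgeStructure.Hom.ext rfl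
  inv_hom_id := MixedHodgeStructure.Hom.ext rfl

/-- The underlying map of `tateTwistTwistIso` is the identity. [cite: CattaniElZeinGriffithsLe2014, Ex. 3.2.23 (4)] -/
@[simp]
theorem tateTwistTwistIso_hom_toLinearMap (j j' : ℤ) (h : j + j' = 0) (X : MixedHodgeStructureCat.{u}) :
    MixedHodgeStructure.Hom.toLinearMap (tateTwistTwistIso j j' h X).hom = LinearMap.id := rfl

/-- **The Tate twist is an autoequivalence of `MixedHodgeStructureCat`** with inverse the opposite twist.
[cite: CattaniElZeinGriffithsLe2014, Ex. 3.2.23 (4)] [cite: DeligneHodgeII1971, 2.1.13–2.1.14] -/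
def tateTwistEquivalence (j : ℤ) : MixedHodgeStructureCat.{u} ≌ MixedHodgeStructureCat.{u} where
  functor := tateTwist j
  inverse := tateTwist (-j)
  unitIso := NatIso.ofComponents (fun X => (tateTwistTwistIso j (-j) (by omega) X).symm)
    (fun _ => MixedHodgeStructure.Hom.ext rfl)
  counitIso := NatIso.ofComponents (fun X => tateTwistTwistIso (-j) j (by omega) X) (fun _ => MixedHodgeStructure.Hom.ext rfl)
  functor_unitIso_comp _ := MixedHodgeStructure.Hom.ext rfl

/-- The functor of `tateTwistEquivalence j` is `tateTwist j`. [cite: CattaniElZeinGriffithsLe2014, Ex. 3.2.23 (4)] -/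
theorem tateTwistEquivalence_functor (j : ℤ) : (tateTwistEquivalence.{u} j).functor = tateTwist j := rfl

/-- The inverse of `tateTwistEquivalence j` is `tateTwist (-j)`. [cite: CattaniElZeinGriffithsLe2014, Ex. 3.2.23 (4)] -/
theorem tateTwistEquivalence_inverse (j : ℤ) : (tateTwistEquivalence.{u} j).inverse = tateTwist (-j) := rfl

/-- The Tate twist is an equivalence of categories. [cite: CattaniElZeinGriffithsLe2014, Ex. 3.2.23 (4)] -/
instance (j : ℤ) : (tateTwist.{u} j).IsEquivalence := (tateTwistEquivalence j).isEquivalence_functor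

/-! ## §3 Compatibility with `W_•`, `Gr^W_•` and Hodge classes -/

/-- **`W_k(X(j)) = W_{k+2j}(X)` as subspaces**: under g43-#4's `subobjectEquiv`, the subobject `W_k` of `X(j)` is the subspace `W_{k+2j} X`
(the weight filtration of the twist is the shifted one). [cite: CattaniElZeinGriffithsLe2014, Ex. 3.2.23 (4)] -/
theorem coe_subobjectEquiv_weightSubobject_tateTwist_obj (j k : ℤ) (X : MixedHodgeStructureCat.{u}) :
    ((subobjectEquiv ((tateTwist j).obj X) (weightSubobject k ((tateTwist j).obj X)) : ((tateTwist j).obj X).str.subLattice) :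
        Submodule ℚ ((tateTwist j).obj X)) = X.str.W (k + 2 * j) :=
  (coe_subobjectEquiv_weightSubobject k ((tateTwist j).obj X)).trans (X.str.tateTwist_W j k)

/-- `W_k(X(j)) = 0 ↔ W_{k+2j}(X) = 0`. [cite: CattaniElZeinGriffithsLe2014, Ex. 3.2.23 (4)] -/
theorem isZero_weightFunctor_obj_tateTwist_obj_iff (j k : ℤ) (X : MixedHodgeStructureCat.{u}) :
    IsZero ((weightFunctor k).obj ((tateTwist j).obj X)) ↔ X.str.W (k + 2 * j) = ⊥ :=
  isZero_weightFunctor_obj_iff k ((tateTwist j).obj X)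

/-- `W_k(X(j)) = X(j) ↔ W_{k+2j}(X) = X`. [cite: CattaniElZeinGriffithsLe2014, Ex. 3.2.23 (4)] -/
theorem isIso_weightι_app_tateTwist_obj_iff (j k : ℤ) (X : MixedHodgeStructureCat.{u}) :
    IsIso ((weightι k).app ((tateTwist j).obj X)) ↔ X.str.W (k + 2 * j) = ⊤ :=
  isIso_weightι_app_iff k ((tateTwist j).obj X)

/-- **`Gr^W_k(X(j)) ≅ (Gr^W_{k+2j} X)(j)`** naturally in `X` (the tree's bijective `tateTwistGrHom`, `[x] ↦ [x]`; the weight `k + 2j - 2j` is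
transported to `k` by `HodgeStructureCat.castFunctor`). [cite: CattaniElZeinGriffithsLe2014, Ex. 3.2.23 (4)] -/
def tateTwistGrIso (j k : ℤ) :
    tateTwist.{u} j ⋙ gr k ≅ gr (k + 2 * j) ⋙ HodgeStructureCat.tateTwist (k + 2 * j) j ⋙ HodgeStructureCat.castFunctor (by ring) :=
  NatIso.ofComponents
    (fun X => @asIso _ _ _ _ (MixedHodgeStructure.tateTwistGrHom X.str j k :
        (tateTwist.{u} j ⋙ gr k).obj X ⟶ (gr (k + 2 * j) ⋙ HodgeStructureCat.tateTwist (k + 2 * j) j ⋙ HodgeStructureCat.castFunctor _).obj X)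
      (HodgeStructureCat.isIso_of_bijective _ (MixedHodgeStructure.tateTwistGrMap_bijective X.str j k)))
    (fun _ => HodgeStructure.Hom.ext (Submodule.linearMap_qext _ (LinearMap.ext fun _ => rfl)))

/-- The components of `tateTwistGrIso` on vectors: `[x] ↦ [x]`. [cite: CattaniElZeinGriffithsLe2014, Ex. 3.2.23 (4)] -/
theorem tateTwistGrIso_hom_app_toLinearMap (j k : ℤ) (X : MixedHodgeStructureCat.{u}) :
    HodgeStructure.Hom.toLinearMap ((tateTwistGrIso j k).hom.app X) = MixedHodgeStructure.tateTwistGrMap X.str j k := rfl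

/-- **`Hdgᵖ(X(j)) = Hdg^{p+j}(X)`** in `MixedHodgeStructureCat`. [cite: Arapura2022, §1 (p. 3)] [cite: CattaniElZeinGriffithsLe2014, Ex. 3.2.23 (4)] -/
theorem hodgeClasses_tateTwist_obj (j p : ℤ) (X : MixedHodgeStructureCat.{u}) :
    ((tateTwist j).obj X).str.hodgeClasses p = X.str.hodgeClasses (p + j) := by
  -- the tree's unbundled `MixedHodgeStructure.hodgeClasses_tateTwist` (Motives/MixedHodgeStructureMultiplicityBounds), reproved in three
  -- lines to keep this file's imports light
  show (X.str.tateTwist j).hodgeClasses p = X.str.hodgeClasses (p + j)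
  ext v
  rw [MixedHodgeStructure.mem_hodgeClasses_iff, MixedHodgeStructure.mem_hodgeClasses_iff, MixedHodgeStructure.tateTwist_W,
    MixedHodgeStructure.tateTwist_F, show 2 * p + 2 * j = 2 * (p + j) by ring]

end MixedHodgeStructureCat

end Literature.AlgebraicGeometry.Motives

end
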